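import Summits.NavierStokesRegularity.NavierStokesRegularity.Theorems.ExtremiserTransienceNearExtremalTransienceExtremiserLiouvilleConstantSpeedSlideInequalityLayer
import Summits.NavierStokesRegularity.NavierStokesRegularity.Theorems.ExtremiserTransienceNearExtremalTransienceExtremiserLiouvilleConstantSpeedSlideLayerWeight
import HarnessLib

/-!
# Crux `ExtremiserTransience.NearExtremalTransience` (stmt-NavierStokesRegularity-21883), line `extremiser_liouville`,
# stub K1b — (INEQ)₃ FOR THE LAYER-STEP PROFILE `g_{a,L}(s) = H((s − a)/L)` (R6b step 0, record §18)

`--supports stmt-NavierStokesRegularity-21883` (helper).  Author: prover seat `ns-el-k1b` (g9).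

`slideInequality_layer` (`…ConstantSpeedSlideInequalityLayer`, p738561) specialised to the admissible profile family of
`…ConstantSpeedSlideLayerWeight`: all profile hypotheses (`hg, hK0–hK3, hT1–hT3, hg0, hγ0`) are discharged, leaving the
hypotheses on the field `v`, the far constant `c`, the slab `T` (with `−T < a`, `a + L < T`) and `h₀`.  The layer weight is
`g′_{a,L}(x₂) = L⁻¹H′((x₂ − a)/L) ≥ 0`, supported in `a ≤ x₂ ≤ a + L`.
* `slideInequality_layerStep` : (INEQ)₃ with `g = g_{a,L}`.

WHAT THIS IS NOT: K1b is NOT proved; nothing here proves NS regularity. [folklore]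
-/

noncomputable section

open Set Filter Topology MeasureTheory Metric Function InnerProductSpace
open scoped ENNReal NNReal Topology InnerProductSpace RealInnerProductSpace ContDiff
open Literature.Analysis.FluidPDE Literature.Analysis

namespace Summit.NavierStokesRegularity.NavierStokesRegularity.Theorems

-- the problem directory repeats the summit name (`NavierStokesRegularity/NavierStokesRegularity`)
set_option linter.dupNamespace false

namespace ExtremiserLiouville

open DepletionLadder.KStar

variable {v : EuclideanSpace ℝ (Fin 3) → EuclideanSpace ℝ (Fin 3)} {c : EuclideanSpace ℝ (Fin 3)}

/-- **(INEQ)₃ for the layer-step profile `g_{a,L}`** (`slideInequality_layer` with the profile hypotheses discharged by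
`…ConstantSpeedSlideLayerWeight`). [folklore] -/
theorem slideInequality_layerStep
    (hv : ContDiff ℝ ∞ v) (hdiv : VectorCalculus.IsDivFree v) {M B : ℝ} (hMpos : 0 < M)
    (hM : ∀ x, ‖v x‖ = M) (hB : ∀ x, ‖fderiv ℝ v x‖ ≤ B)
    (h1 : ∫⁻ x, ‖iteratedFDeriv ℝ 1 v x‖ₑ ^ 2 < ⊤) (h2 : ∫⁻ x, ‖iteratedFDeriv ℝ 2 v x‖ₑ ^ 2 < ⊤)
    (hatt : |∫ x, ⟪curl v x, fderiv ℝ v x (curl v x)⟫| = (sInf {κ : ℝ | (∀ (v : EuclideanSpace ℝ (Fin 3) → EuclideanSpace ℝ (Fin 3)) (M B : ℝ), ContDiff ℝ (⊤ : ℕ∞) v → Literature.Analysis.FluidPDE.VectorCalculus.IsDivFree v → (∀ x, ‖v x‖ ≤ M) → (∀ x, ‖fderiv ℝ v x‖ ≤ B) → (∫⁻ x, ‖iteratedFDeriv ℝ 0 v x‖ₑ ^ 2 < ⊤) → (∫⁻ x, ‖iteratedFDeriv ℝ 1 v x‖ₑ ^ 2 < ⊤) → (∫⁻ x, ‖iteratedFDeriv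 ℝ 2 v x‖ₑ ^ 2 < ⊤) → |∫ x, ⟪Literature.Analysis.FluidPDE.curl v x, fderiv ℝ v x (Literature.Analysis.FluidPDE.curl v x)⟫_ℝ| ≤ κ * M * Real.sqrt (∫ x, ‖Literature.Analysis.FluidPDE.curl v x‖ ^ 2) * Real.sqrt (∫ x, Literature.Analysis.FluidPDE.frobeniusNormSq (fderiv ℝ (Literature.Analysis.FluidPDE.curl v) x)))}) * M * Real.sqrt (∫ x, ‖curl v x‖ ^ 2) * Real.sqrt (∫ x, frobeniusNormSq (fderiv ℝ (curl v) x)))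
    (hc0 : c 0 = 0) (hc1 : c 1 = 0) (hcM : ‖c‖ = M)
    {a L T : ℝ} (hL : 0 < L) (hT : 0 < T) (haT : -T < a) (haLT : a + L < T)
    (hslab : Integrable (fun x => {x : EuclideanSpace ℝ (Fin 3) | |x 2| ≤ T}.indicator (fun x => ‖v x - c‖ ^ 2) x) volume)
    {h₀ : ℝ} (hh₀ : 0 < h₀) (hfar : ∀ x : EuclideanSpace ℝ (Fin 3), |x 2| ≤ T + h₀ → ‖v x - c‖ ^ 2 ≤ 2 * M ^ 2) :
    (∫ x, ⟪curl v x, fderiv ℝ v x (curl v x)⟫) *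
        (-(-(∫ x, deriv (fun s : ℝ => Real.smoothTransition ((s - a) / L)) (x 2) * ⟪curl v x, fderiv ℝ v x (curl v x)⟫) +
          (∫ x, deriv (fun s : ℝ => Real.smoothTransition ((s - a) / L)) (x 2) *
          (⟪((-2 * fderiv ℝ v x (EuclideanSpace.single (2 : Fin 3) (1 : ℝ)) 1) • EuclideanSpace.single (0 : Fin 3) (1 : ℝ) + (2 * fderiv ℝ v x (EuclideanSpace.single (2 : Fin 3) (1 : ℝ)) 0) • EuclideanSpace.single (1 : Fin 3) (1 : ℝ) + (curl v x 2) • EuclideanSpace.single (2 : Fin 3) (1 : ℝ)), fderiv ℝ v x (curl v x)⟫ +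
            curl v x 2 * ⟪curl v x, fderiv ℝ v x (EuclideanSpace.single (2 : Fin 3) (1 : ℝ))⟫ +
            ⟪curl v x, fderiv ℝ v x (curl v x) - (fderiv ℝ v x (curl v x) 2) • EuclideanSpace.single (2 : Fin 3) (1 : ℝ)⟫ +
            ⟪curl v x, fderiv ℝ v x ((-2 * fderiv ℝ v x (EuclideanSpace.single (2 : Fin 3) (1 : ℝ)) 1) • EuclideanSpace.single (0 : Fin 3) (1 : ℝ) + (2 * fderiv ℝ v x (EuclideanSpace.single (2 : Fin 3) (1 : ℝ)) 0) • EuclideanSpace.single (1 : Fin 3) (1 : ℝ) + (curl v x 2) • EuclideanSpace.single (2 : Fin 3) (1 : ℝ))⟫)) +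
          ∫ x, deriv (deriv (fun s : ℝ => Real.smoothTransition ((s - a) / L))) (x 2) *
          (⟪((-(v x - c) 1) • EuclideanSpace.single (0 : Fin 3) (1 : ℝ) + ((v x - c) 0) • EuclideanSpace.single (1 : Fin 3) (1 : ℝ)), fderiv ℝ v x (curl v x)⟫ +
            curl v x 2 * ⟪curl v x, v x - c - ((v x - c) 2) • EuclideanSpace.single (2 : Fin 3) (1 : ℝ)⟫ +
            ⟪curl v x, fderiv ℝ v x ((-(v x - c) 1) • EuclideanSpace.single (0 : Fin 3) (1 : ℝ) + ((v x - c) 0) • EuclideanSpace.single (1 : Fin 3) (1 : ℝ))⟫))) ≤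
      (sInf {κ : ℝ | (∀ (v : EuclideanSpace ℝ (Fin 3) → EuclideanSpace ℝ (Fin 3)) (M B : ℝ), ContDiff ℝ (⊤ : ℕ∞) v → Literature.Analysis.FluidPDE.VectorCalculus.IsDivFree v → (∀ x, ‖v x‖ ≤ M) → (∀ x, ‖fderiv ℝ v x‖ ≤ B) → (∫⁻ x, ‖iteratedFDeriv ℝ 0 v x‖ₑ ^ 2 < ⊤) → (∫⁻ x, ‖iteratedFDeriv ℝ 1 v x‖ₑ ^ 2 < ⊤) → (∫⁻ x, ‖iteratedFDeriv ℝ 2 v x‖ₑ ^ 2 < ⊤) → |∫ x, ⟪Literature.Analysis.FluidPDE.curl v x, fderiv ℝ v x (Literature.Analysis.FluidPDE.curl v x)⟫_ℝ| ≤ κ * M * Real.sqrt (∫ x, ‖Literature.Analysis.FluidPDE.curl v x‖ ^ 2) * Real.sqrt (∫ x, Literature.Analysis.FluidPDE.frobeniusNormSq (fderiv ℝ (Literature.Analysis.FluidPDE.curl v) x)))}) ^ 2 * M ^ 2 *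
        ((∫ x, frobeniusNormSq (fderiv ℝ (curl v) x)) *
          (-((∫ x, deriv (fun s : ℝ => Real.smoothTransition ((s - a) / L)) (x 2) *
          ((3 / 2) * (fderiv ℝ v x (EuclideanSpace.single 2 1) 0 ^ 2 + fderiv ℝ v x (EuclideanSpace.single 2 1) 1 ^ 2) +
            (1 / 2) * curl v x 2 ^ 2 -
            (1 / 2) * (fderiv ℝ v x (EuclideanSpace.single 0 1) 2 ^ 2 + fderiv ℝ v x (EuclideanSpace.single 1 1) 2 ^ 2) -
            (fderiv ℝ v x (EuclideanSpace.single 0 1) 2 * fderiv ℝ v x (EuclideanSpace.single 2 1) 0 +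
              fderiv ℝ v x (EuclideanSpace.single 1 1) 2 * fderiv ℝ v x (EuclideanSpace.single 2 1) 1))) +
        2 * (∫ x, deriv (fun s : ℝ => Real.smoothTransition ((s - a) / L)) (x 2) * (fderiv ℝ v x (EuclideanSpace.single (2 : Fin 3) (1 : ℝ)) 2) ^ 2) +
        2 * ∫ x, deriv (fun s : ℝ => Real.smoothTransition ((s - a) / L)) (x 2) *
          (fderiv ℝ v x (EuclideanSpace.single 0 1) 2 * fderiv ℝ v x (EuclideanSpace.single 2 1) 0 +
            fderiv ℝ v x (EuclideanSpace.single 1 1) 2 * fderiv ℝ v x (EuclideanSpace.single 2 1) 1))) +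
          (∫ x, ‖curl v x‖ ^ 2) *
          (-((1 / 2) * ∫ x, deriv (fun s : ℝ => Real.smoothTransition ((s - a) / L)) (x 2) * frobeniusNormSq (fderiv ℝ (curl v) x)) -
          (∫ x, deriv (deriv (fun s : ℝ => Real.smoothTransition ((s - a) / L))) (x 2) * ⟪fderiv ℝ (curl v) x (EuclideanSpace.single (2 : Fin 3) (1 : ℝ)), curl v x⟫ +
        deriv (fun s : ℝ => Real.smoothTransition ((s - a) / L)) (x 2) * ‖fderiv ℝ (curl v) x (EuclideanSpace.single (2 : Fin 3) (1 : ℝ))‖ ^ 2 +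
        deriv (deriv (deriv (fun s : ℝ => Real.smoothTransition ((s - a) / L)))) (x 2) * ⟪fderiv ℝ (curl v) x (EuclideanSpace.single (2 : Fin 3) (1 : ℝ)),
          (-(v x - c) 1) • EuclideanSpace.single (0 : Fin 3) (1 : ℝ) + ((v x - c) 0) • EuclideanSpace.single (1 : Fin 3) (1 : ℝ)⟫ +
        deriv (deriv (fun s : ℝ => Real.smoothTransition ((s - a) / L))) (x 2) * ⟪fderiv ℝ (curl v) x (EuclideanSpace.single (2 : Fin 3) (1 : ℝ)),
          fderiv ℝ (fun z : EuclideanSpace ℝ (Fin 3) =>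
            (-(v z - c) 1) • EuclideanSpace.single (0 : Fin 3) (1 : ℝ) + ((v z - c) 0) • EuclideanSpace.single (1 : Fin 3) (1 : ℝ)) x
            (EuclideanSpace.single (2 : Fin 3) (1 : ℝ))⟫ +
        ∑ i : Fin 3, (deriv (deriv (fun s : ℝ => Real.smoothTransition ((s - a) / L))) (x 2) * ⟪fderiv ℝ (curl v) x (EuclideanSpace.basisFun (Fin 3) ℝ i),
            fderiv ℝ (fun z : EuclideanSpace ℝ (Fin 3) =>
              (-(v z - c) 1) • EuclideanSpace.single (0 : Fin 3) (1 : ℝ) + ((v z - c) 0) • EuclideanSpace.single (1 : Fin 3) (1 : ℝ)) x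
              (EuclideanSpace.basisFun (Fin 3) ℝ i)⟫ +
          deriv (fun s : ℝ => Real.smoothTransition ((s - a) / L)) (x 2) * ⟪fderiv ℝ (curl v) x (EuclideanSpace.basisFun (Fin 3) ℝ i),
            fderiv ℝ (fun y : EuclideanSpace ℝ (Fin 3) => fderiv ℝ (fun z : EuclideanSpace ℝ (Fin 3) =>
              (-(v z - c) 1) • EuclideanSpace.single (0 : Fin 3) (1 : ℝ) + ((v z - c) 0) • EuclideanSpace.single (1 : Fin 3) (1 : ℝ)) y
              (EuclideanSpace.basisFun (Fin 3) ℝ i)) x (EuclideanSpace.single (2 : Fin 3) (1 : ℝ))⟫)) +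
          ∫ x, deriv (deriv (fun s : ℝ => Real.smoothTransition ((s - a) / L))) (x 2) * (fderiv ℝ (curl v) x (EuclideanSpace.single (2 : Fin 3) (1 : ℝ)) 0 * fderiv ℝ v x (EuclideanSpace.single (1 : Fin 3) (1 : ℝ)) 2 -
          fderiv ℝ (curl v) x (EuclideanSpace.single (2 : Fin 3) (1 : ℝ)) 1 * fderiv ℝ v x (EuclideanSpace.single (0 : Fin 3) (1 : ℝ)) 2) +
        deriv (fun s : ℝ => Real.smoothTransition ((s - a) / L)) (x 2) * ∑ i : Fin 3, (fderiv ℝ (curl v) x (EuclideanSpace.basisFun (Fin 3) ℝ i) 0 *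
            fderiv ℝ (fun y => fderiv ℝ v y (EuclideanSpace.single (1 : Fin 3) (1 : ℝ))) x (EuclideanSpace.basisFun (Fin 3) ℝ i) 2 -
          fderiv ℝ (curl v) x (EuclideanSpace.basisFun (Fin 3) ℝ i) 1 *
            fderiv ℝ (fun y => fderiv ℝ v y (EuclideanSpace.single (0 : Fin 3) (1 : ℝ))) x (EuclideanSpace.basisFun (Fin 3) ℝ i) 2))) := by
  obtain ⟨D₁, D₂, D₃, -, -, -, hD⟩ := exists_bounds_derivs_layerStep
  exact slideInequality_layer hv hdiv hMpos hM hB h1 h2 hatt hc0 hc1 hcM (contDiff_layerStep (a := a) (L := L)) hT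
    (fun s => abs_layerStep_le_one (a := a) (L := L) s) (fun s => (hD a L hL s).1) (fun s => (hD a L hL s).2.1)
    (fun s => (hD a L hL s).2.2) (fun s hs => (derivs_layerStep_eq_zero_of_le_abs hL haT haLT hs).1)
    (fun s hs => (derivs_layerStep_eq_zero_of_le_abs hL haT haLT hs).2.1)
    (fun s hs => (derivs_layerStep_eq_zero_of_le_abs hL haT haLT hs).2.2) (fun s => layerStep_nonneg (a := a) (L := L) s)
    (deriv_layerStep_nonneg hL) hslab hh₀ hfar

end ExtremiserLiouville

end Summit.NavierStokesRegularity.NavierStokesRegularity.Theorems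

end
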